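/-
Copyright (c) 2026 the pub-hodgecm-mathlib formalisation cell (harness21).  Prover seat hodgecm-mathlib-LH4-p08 (g9), req620 Track A «(D-RAM) FOUR-FRAME» squad
(STAGE-1b, row-(2) type-U lane; second hand to LH4-p07 (g9)'s (LAW) END), 2026-09-04.
-/
import Summits.HodgeConjecture.HodgeConjecture.Theorems.F0P3cDyRamOrderCountCensusUnr            -- ★ socket (A) (LH4-p11 (g5)): every organ of the type-U bottom, by import
import Summits.HodgeConjecture.HodgeConjecture.Theorems.F0P3cDyRamLevelsCensusUnrFrameLaw        -- (this seat): the frame law in cutoff currency (★ p860069 ∘ generic arithmetic ∘ inert bottom)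
import Summits.HodgeConjecture.HodgeConjecture.Theorems.F0P3cDyRamLevelsCensusCutoffCM           -- ★ p860083 (LH4-p07 (g9)): (C2-lev-cutoff-CM) §1∕§2; brings `LatticeInLevel`
import Summits.HodgeConjecture.HodgeConjecture.Theorems.F0P3cDyRamLevelsSocketPrelude            -- ★ p860127 (LH4-p07 (g9)): near-1 token letters
import Summits.HodgeConjecture.HodgeConjecture.Theorems.F0P3cDyRamTokenDepthNearOne              -- ★ (LH4 lineage): `eventually_nhds_one_le_tokenDepth`
import Summits.HodgeConjecture.HodgeConjecture.Theorems.F0P3cDyRamRowOneRootDepth                -- ★ `eventually_nhds_one_valued_trace_sub_two_le`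
import Literature.NumberTheory.Rogawski1990.FinExplicitTransferFactorDeepTauUniform               -- ★ `eventually_nhds_one_valued_sub_one_le`
import HarnessLib

/-!
# Crux `H413`, line LH4 «(D-RAM) FOUR-FRAME» — STAGE-1b, row (2): SOCKET (A)-lev «THE TWO-LITERAL CENSUS LAW OF A LEVEL PIECE, TYPE U, AT THE CM PLACE»
# `(q − 1)·q^{ks}·(cnt_{a,b}(ι t_h) − cnt_{a,b}(ι t_a)) = (β, θ)_v·q^m·((q − 1)(#Fix_{γ₂}(U₂⧸K_H) + d%2) + 2 − 2q^T)`

Cell `hodgecm-mathlib` (D-0151), FLOOR 0, crux item H413 = `stmt-HodgeConjecture-24833`, route of record `HCCMUnconditional`; squad F0∕P3c∕LH4; lane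
`--supports stmt-HodgeConjecture-24833 --as helper` (count-neutral; pays NO tier-0 row).  ONE THEOREM (no `def`, no instance, no notation, no `sorry`).
The TYPE-U LANE of the END `levels_typeTwo_censusLaw (a b) (cA cB)` (★ p859606's `hLaw`), slot (A) of LH4-p06 (g7)'s `levelsCensus2_of_types`; second hand to LH4-p07
(g9)'s RamK socket `levelsCensusB` (SIG fc50d796 → v2), whose binder list this statement copies with the two DESCENT-TYPE letters of ★ `orderCountCensusA` (:111–:112).

THE STATEMENT.  ★ `F0P3cDyRamOrderCountCensusUnr.orderCountCensusA`'s binder list BYTE-VERBATIM (place, ramified datum, `|2|_w < 1`, `∃ V ∈ 𝓝 1`, `∀ γ_H ∈ V` G-regular of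
type (2), the third field `(E′, c₁, δ, m₀, s, w₁, Θ, α, λ)` of TYPE U (`|α − ρα| = 1`, `|ρα − Θα| < 1`) with its letters, the literals `(t_h, t_a, P₁, dg, η, γ₁)`, the two line
models `(φ, h, φ′, h′)`, `hjpow hEval hϖmax`, `(J R R′ f f′)` with the finiteness∕depth∕glue letters) + FOUR piece parameters **`(a b ks T : ℕ)`** under `a ≤ d`,
`d + 2a ≤ b + 1` and LH4-p07 (g9)'s GENERAL RULE (`2ks + 2⌊(d + a%2)∕2⌋ = a + a%2 + b + b%2`; `a` even ⇒ `T + a = ks + (d − d%2)`; `a` odd ⇒ `T + a + 1 = ks + (d − d%2) + 2(d%2)`;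
rows of record sq ∕ lev_lo ∕ lev_hi ∕ T₊-lo ∕ T₊-hi).  Conclusion: (i) doubly fixed units are `Θ`-norms; (ii) for every m-token and side symbol `β`,
**`(q − 1)·q^{ks}·((cnt_{a,b}(ι t_h) : ℤ) − cnt_{a,b}(ι t_a)) = (β,θ)_v·q^m·((q − 1)(#Fix + d%2) + 2 − 2q^T)`**, the censuses being ★ p859606's `hLaw` sets VERBATIM
(`{M | IsVertexLattice σ_w ϖ (antidiag 3) 0 M ∧ mapGL (ι t) M = M ∧ LatticeInLevel ϖ a (ι t − 1) M ∧ LatticeInLevel ϖ b ((ι t − 1)²) M}.ncard`); the conclusion ≡ LH4-p06 (g7)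
FILE A's `hA` binder (whitespace-normalised tie, SIG `SIG-levelsCensusA.skel.v1` 42046bc8).

THE PROOF — ★ (A)'s skeleton with the level-piece organs swapped in: `V` = the block congruence at `ϖ^(2d+5tE+2)` (★ brick 6) ∩ m-tokens `≥ a + b + 2d + 2` (★
`exists∕eventually_nhds_one_le_tokenDepth`) ∩ the near-1 ball `|u_w − 1|, |det − 1|, |tr − 2| ≤ |ϖ^{2(a+b+2d+2)}|` (★ `eventually_nhds_one_valued_sub_one_le` ∕ ★
`…_trace_sub_two_le`); type-U isometry (★ p10), the `hFN` clause (★ brick 1), tube letters (★ bricks 5∕7), the H-side organ (★ LH4-p09) with the type-(A) branch kill (★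
brick 8) ⇒ the INERT law `(q − 1)(#Fix + d%2) + 2 = (q + 1)qⁿ`, `jλ = 2n`; `u₀₀`, the m-token (★ brick 4), the flip unit (★ (β)), the hermitian letters and GAP-R (★ LH4-p05) as
(A); then the NEAR-1 LEVEL LETTERS (★ p860127 §2: `|λ − 1| ≤ |ϖ|^{a+b+2d+2}` ⇒ `hlev`, `hlev2`, `hdeep`, `huc`, `huc2`, `a ≤ jλ`, tokens `m₁ = m − a`, `nν ≥ a+b+2d+2`,
`m₂ = m + nν − b`) → ★ p860083 §1∕§2 (each literal's census in cutoff currency) → `exact` ★ `levelsCutCensus_unr_law_of_frame` (this seat: ★ S2′ third field, (β′) weights,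
★ p860069 weld by the lane `a % 2`, ★ p860376 generic closing arithmetic, inert `ℤ` bottom), with the sign `(β, θ)_v = (−1)^(m+d)` (★ O-Sign `sign_typeA`) and realizability
(★ LH4-p14 `hreal_of_frame_typeU`).
HONEST LABEL.  Count-neutral; the U lane only (RamK: LH4-p07 (g9); RamM: second hand); no tier-0 row is paid by this file; `HC_CM` is proved only modulo the 7 printed
citations (2 remaining named inputs: hLiu418 = `stmt-HodgeConjecture-24832`, h413 = `stmt-HodgeConjecture-24833`) until rung 0 closes.

## References
* [Rogawski1990] J. D. Rogawski, *Automorphic Representations of Unitary Groups in Three Variables*, Ann. of Math. Stud. 123 (1990): §4.9 Prop. 4.9.1 (b) p. 55, Lemma 4.9.3 p. 56; §12.2.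
* [Kottwitz1986BaseChangeUnits] R. E. Kottwitz, *Base change for unit elements of Hecke algebras*, Compositio Math. 60 (1986): §1 pp. 240–241.
* [LabesseLanglands1979] J.-P. Labesse, R. P. Langlands, *L-indistinguishability for SL(2)*, Canad. J. Math. 31 (1979): §2 pp. 8–10.
* [Serre1979] J.-P. Serre, *Local Fields*, GTM 67 (1979): Ch. II §1; Ch. V §3 Prop. 5, Cor. 3. -/
set_option autoImplicit false

noncomputable section

namespace Summit.HodgeConjecture.HodgeConjecture.Cruxes.H413.F0P3cDyRamLevelsCensusUnr

open MeasureTheory Measure NumberField IsDedekindDomain Topology Filter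
open Literature.NumberTheory.Automorphic Literature.NumberTheory.Automorphic.UnitaryGroup Literature.NumberTheory.Automorphic.IntegralReduction
open Literature.NumberTheory.Rogawski1990 Literature.NumberTheory.GaloisRepresentations
open Literature.NumberTheory.Automorphic.UnitaryThreeFourFrame
open scoped Matrix MatrixGroups Classical Valued
open Literature.NumberTheory.Automorphic.UnitaryLatticeTree Literature.NumberTheory.Automorphic.HermitianLattice
open Literature.NumberTheory.QuadraticForms
open Summit.HodgeConjecture.HodgeConjecture.Cruxes.H413.F0P3cDyRamToricCensusDefs
open Summit.HodgeConjecture.HodgeConjecture.Cruxes.H413.F0P3cDyRamFourFrameCensusDefs (LatticeInLevel)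
open Summit.HodgeConjecture.HodgeConjecture.Cruxes.H413.F0P3cDyRamTokenDepthNearOne (eventually_nhds_one_le_tokenDepth)
open Summit.HodgeConjecture.HodgeConjecture.Cruxes.H413.F0P3cDyRamRowOneRootDepth (eventually_nhds_one_valued_trace_sub_two_le)
open Summit.HodgeConjecture.HodgeConjecture.Cruxes.H413.F0P3cDyRamLevelsCensusCutoffCM (ncard_typeZero_fixed_endoGL_levels_eq_cutoff_unr ncard_typeZero_fixed_conj_endoGL_levels_eq_cutoff_unr)
open Summit.HodgeConjecture.HodgeConjecture.Cruxes.H413.F0P3cDyRamJointProfileCensusGuardLetter (sub_one_sq_sub_map_sub_one_sq)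
open Summit.HodgeConjecture.HodgeConjecture.Cruxes.H413.F0P3cDyRamLevelsCensusUnrFrameLaw (levelsCutCensus_unr_law_of_frame)

set_option maxHeartbeats 4000000 in
-- budget only: the statement alone is ≈ 24 000 normalised characters of binders (socket (A)'s + the two level censuses); the proof is a composition of ★ organs (no search).
/-- **SOCKET (A)-lev — THE TWO-LITERAL CENSUS LAW OF THE LEVEL PIECE `lev(a, b)` ON TYPE U** (★ socket (A)'s binders verbatim + the piece `(a b ks T)` with its exponent rule):
near `1 ∈ H_v`, for every admissible `γ_H`, every type-U third field and literal data, (i) doubly fixed units are `Θ`-norms and (ii)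
`(q − 1)·q^{ks}·(cnt_{a,b}(ι t_h) − cnt_{a,b}(ι t_a)) = (β, θ)_v·q^m·((q − 1)(#Fix_{γ₂}(U₂⧸K_H) + d % 2) + 2 − 2q^T)`.  Composition over the ★ organs listed in the module docstring.
[cite: Rogawski1990, §4.9 Prop. 4.9.1 (b) p. 55, Lemma 4.9.3 p. 56] [cite: Kottwitz1986BaseChangeUnits, §1 pp. 240–241] [cite: LabesseLanglands1979, §2 pp. 8–10] [cite: Serre1979, Ch. V §3 Prop. 5, Cor. 3] -/
theorem levelsCensusA (L : Type) [Field L] [NumberField L] [IsCMField L]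
    {v : HeightOneSpectrum (𝓞 ↥(maximalRealSubfield L))} (w : UnitaryGroup.PlacesOver L v)
    (hw : IsCMField.complexConj L • w.1 = w.1) (he : v.asIdeal.ramificationIdx' w.1.asIdeal ≠ 1)
    (ϖ : (w.1.adicCompletion L)) (hϖ : Valued.v ϖ = WithZero.exp (-1 : ℤ)) (d tE : ℕ)
    (hD : IsRamifiedQuadraticDatum (galAdicCompletionMap (L := L) (IsCMField.complexConj L) hw) ϖ d tE)
    (h2v : Valued.v (2 : (w.1.adicCompletion L)) < 1)
    [Fintype (Valued.ResidueField (w.1.adicCompletion L))]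
    (a b ks T : ℕ) (had : a ≤ d) (hab1 : d + 2 * a ≤ b + 1)
    (hks : 2 * ks + 2 * ((d + a % 2) / 2) = a + a % 2 + (b + b % 2))
    (hT0 : a % 2 = 0 → T + a = ks + (d - d % 2)) (hT1 : a % 2 = 1 → T + a + 1 = ks + (d - d % 2) + 2 * (d % 2)) :
      ∃ V ∈ 𝓝 (1 : ((UnitaryGroup.cmDatum L 2 (Matrix.of fun i j : Fin 2 => if i.val + j.val + 1 = 2 then (1 : L) else 0)).Local v × (UnitaryGroup.cmDatum L 1 (Matrix.of fun i j : Fin 1 => if i.val + j.val + 1 = 1 then (1 : L) else 0)).Local v)), ∀ γH ∈ V, IsLocalGRegular L v γH →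
        ¬ (∃ x : (w.1.adicCompletion L), (((((γH).1.val : GL (Fin 2) (UnitaryGroup.LocalRing L v)).val.map (Pi.evalRingHom (fun w' : UnitaryGroup.PlacesOver L v => w'.1.adicCompletion L) w))).charpoly).IsRoot x) →
        ∀ (E' : Type) [Field E'] [NumberField E'] [Algebra L E'] [Algebra.IsQuadraticExtension L E'] (c₁ : E' ≃ₐ[L] E') (δ : E') (m₀ : L)
          (s : (w.1.adicCompletion L)) (w₁ : UnitaryGroup.PlacesOver E' w.1) (hw₁ : c₁ • w₁.1 = w₁.1)
          (Θ : (w₁.1.adicCompletion E') →+* (w₁.1.adicCompletion E')) (α lam : (w₁.1.adicCompletion E')),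
          c₁ ≠ 1 → c₁ δ = -δ → δ ≠ 0 → algebraMap L E' m₀ = δ ^ 2 → s ≠ 0 →
          (((γH.1.val : GL (Fin 2) (UnitaryGroup.LocalRing L v)).val.map (Pi.evalRingHom (fun w' : UnitaryGroup.PlacesOver L v => w'.1.adicCompletion L) w))).trace * (((γH.1.val : GL (Fin 2) (UnitaryGroup.LocalRing L v)).val.map (Pi.evalRingHom (fun w' : UnitaryGroup.PlacesOver L v => w'.1.adicCompletion L) w))).trace - 4 * (((γH.1.val : GL (Fin 2) (UnitaryGroup.LocalRing L v)).val.map (Pi.evalRingHom (fun w' : UnitaryGroup.PlacesOver L v => w'.1.adicCompletion L) w))).det = s * s * ((m₀ : L) : (w.1.adicCompletion L)) →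
          (((γH.1.val : GL (Fin 2) (UnitaryGroup.LocalRing L v)).val.map (Pi.evalRingHom (fun w' : UnitaryGroup.PlacesOver L v => w'.1.adicCompletion L) w))).det * (galAdicCompletionMap (L := L) (IsCMField.complexConj L) hw) (((γH.1.val : GL (Fin 2) (UnitaryGroup.LocalRing L v)).val.map (Pi.evalRingHom (fun w' : UnitaryGroup.PlacesOver L v => w'.1.adicCompletion L) w))).det = 1 → (((γH.1.val : GL (Fin 2) (UnitaryGroup.LocalRing L v)).val.map (Pi.evalRingHom (fun w' : UnitaryGroup.PlacesOver L v => w'.1.adicCompletion L) w))).trace = (((γH.1.val : GL (Fin 2) (UnitaryGroup.LocalRing L v)).val.map (Pi.evalRingHom (fun w' : UnitaryGroup.PlacesOver L v => w'.1.adicCompletion L) w))).det * (galAdicCompletionMap (L := L) (IsCMField.complexConj L) hw) (((γH.1.val : GL (Fin 2) (UnitaryGroup.LocalRing L v)).val.map (Pi.evalRingHom (fun w' : UnitaryGroup.PlacesOver L v => w'.1.adicCompletion L) w))).trace →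
          (∀ x : (w.1.adicCompletion L), x * x - (((γH.1.val : GL (Fin 2) (UnitaryGroup.LocalRing L v)).val.map (Pi.evalRingHom (fun w' : UnitaryGroup.PlacesOver L v => w'.1.adicCompletion L) w))).trace * x + (((γH.1.val : GL (Fin 2) (UnitaryGroup.LocalRing L v)).val.map (Pi.evalRingHom (fun w' : UnitaryGroup.PlacesOver L v => w'.1.adicCompletion L) w))).det ≠ 0) →
          (∀ z, galAdicCompletionMap (L := E') c₁ hw₁ (galAdicCompletionMap (L := E') c₁ hw₁ z) = z) →
          (∀ z, Valued.v (galAdicCompletionMap (L := E') c₁ hw₁ z) = Valued.v z) →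
          (∀ a, galAdicCompletionMap (L := E') c₁ hw₁ (toPlace w.1 w₁ a) = toPlace w.1 w₁ a) →
          (∀ a, Valued.v (toPlace w.1 w₁ a) ≤ 1 ↔ Valued.v a ≤ 1) →
          (∀ z : (w₁.1.adicCompletion E'), galAdicCompletionMap (L := E') c₁ hw₁ z = z ↔ ∃ a, toPlace w.1 w₁ a = z) →
          (∀ a, Θ (toPlace w.1 w₁ a) = toPlace w.1 w₁ ((galAdicCompletionMap (L := L) (IsCMField.complexConj L) hw) a)) →
          (∀ z, Θ (Θ z) = z) →
          (∀ z, Θ (galAdicCompletionMap (L := E') c₁ hw₁ z) = galAdicCompletionMap (L := E') c₁ hw₁ (Θ z)) →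
          (∀ z, Valued.v (Θ z) = Valued.v z) →
          galAdicCompletionMap (L := E') c₁ hw₁ α ≠ α →
          Valued.v α ≤ 1 →
          (∀ z : (w₁.1.adicCompletion E'), Valued.v z ≤ 1 → Valued.v ((z - galAdicCompletionMap (L := E') c₁ hw₁ z) / (α - galAdicCompletionMap (L := E') c₁ hw₁ α)) ≤ 1) →
          2 * lam = toPlace w.1 w₁ (((γH.1.val : GL (Fin 2) (UnitaryGroup.LocalRing L v)).val.map (Pi.evalRingHom (fun w' : UnitaryGroup.PlacesOver L v => w'.1.adicCompletion L) w))).trace + toPlace w.1 w₁ s * ((δ : E') : (w₁.1.adicCompletion E')) →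
          lam * lam = toPlace w.1 w₁ (((γH.1.val : GL (Fin 2) (UnitaryGroup.LocalRing L v)).val.map (Pi.evalRingHom (fun w' : UnitaryGroup.PlacesOver L v => w'.1.adicCompletion L) w))).trace * lam - toPlace w.1 w₁ (((γH.1.val : GL (Fin 2) (UnitaryGroup.LocalRing L v)).val.map (Pi.evalRingHom (fun w' : UnitaryGroup.PlacesOver L v => w'.1.adicCompletion L) w))).det →
          galAdicCompletionMap (L := E') c₁ hw₁ lam = toPlace w.1 w₁ (((γH.1.val : GL (Fin 2) (UnitaryGroup.LocalRing L v)).val.map (Pi.evalRingHom (fun w' : UnitaryGroup.PlacesOver L v => w'.1.adicCompletion L) w))).trace - lam →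
          Θ lam * lam = 1 →
          Valued.v lam = 1 →
          (∀ z : (w₁.1.adicCompletion E'), ∃! pq : (w.1.adicCompletion L) × (w.1.adicCompletion L), z = toPlace w.1 w₁ pq.1 + toPlace w.1 w₁ pq.2 * lam) →
          Valued.v (α - (galAdicCompletionMap (L := E') c₁ hw₁) α) = 1 →
          Valued.v ((galAdicCompletionMap (L := E') c₁ hw₁) α - Θ α) < 1 →
          ∀ (th ta : ((UnitaryGroup.cmDatum L 3 (Matrix.of fun i j : Fin 3 => if i.val + j.val + 1 = 3 then (1 : L) else 0)).Local v)) (P₁ : GL (Fin 3) (w.1.adicCompletion L)) (dg : Fin 2 → (w.1.adicCompletion L)) (η : (w.1.adicCompletion L)) (γ₁ : GL (Fin 2) (w.1.adicCompletion L)),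
            ((localNonsplitEquiv (IsCMField.complexConj L) (Matrix.of fun i j : Fin 3 => if i.val + j.val + 1 = 3 then (1 : L) else 0) (IsCMField.complexConj_ne_one L) w hw th : ↥(unitaryGroupOfForm (galAdicCompletionMap (L := L) (IsCMField.complexConj L) hw) (placeForm (Matrix.of fun i j : Fin 3 => if i.val + j.val + 1 = 3 then (1 : L) else 0) w.1))) : GL (Fin 3) (w.1.adicCompletion L)) = endoGL (((localNonsplitEquiv (IsCMField.complexConj L) (Matrix.of fun i j : Fin 2 => if i.val + j.val + 1 = 2 then (1 : L) else 0) (IsCMField.complexConj_ne_one L) w hw γH.1 : ↥(unitaryGroupOfForm (galAdicCompletionMap (L := L) (IsCMField.complexConj L) hw) (placeForm (Matrix.of fun i j : Fin 2 => if i.val + j.val + 1 = 2 then (1 : L) else 0) w.1))) : GL (Fin 2) (w.1.adicCompletion L)), ((localNonsplitEquiv (IsCMField.complexConj L) (Matrix.of fun i j : Fin 1 => if i.val + j.val + 1 = 1 then (1 : L) else 0) (IsCMField.complexConj_ne_one L) w hw γH.2).val : GL (Fin 1) (w.1.adicCompletion L))) →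
            ((localNonsplitEquiv (IsCMField.complexConj L) (Matrix.of fun i j : Fin 3 => if i.val + j.val + 1 = 3 then (1 : L) else 0) (IsCMField.complexConj_ne_one L) w hw ta : ↥(unitaryGroupOfForm (galAdicCompletionMap (L := L) (IsCMField.complexConj L) hw) (placeForm (Matrix.of fun i j : Fin 3 => if i.val + j.val + 1 = 3 then (1 : L) else 0) w.1))) : GL (Fin 3) (w.1.adicCompletion L)) = P₁ * endoGL (γ₁, ((localNonsplitEquiv (IsCMField.complexConj L) (Matrix.of fun i j : Fin 1 => if i.val + j.val + 1 = 1 then (1 : L) else 0) (IsCMField.complexConj_ne_one L) w hw γH.2).val : GL (Fin 1) (w.1.adicCompletion L))) * P₁⁻¹ →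
            formCongr (galAdicCompletionMap (L := L) (IsCMField.complexConj L) hw) P₁ (placeForm (Matrix.of fun i j : Fin 3 => if i.val + j.val + 1 = 3 then (1 : L) else 0) w.1) = (!![(Matrix.diagonal dg) 0 0, 0, (Matrix.diagonal dg) 0 1; 0, η, 0; (Matrix.diagonal dg) 1 0, 0, (Matrix.diagonal dg) 1 1] : Matrix (Fin 3) (Fin 3) (w.1.adicCompletion L)) →
            (∀ i, Valued.v (dg i) = 1) →
            (∀ i, (galAdicCompletionMap (L := L) (IsCMField.complexConj L) hw) (dg i) = dg i) →
            (galAdicCompletionMap (L := L) (IsCMField.complexConj L) hw) η = η →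
            Valued.v η = 1 →
            (¬ ∃ t : (w.1.adicCompletion L), t * (galAdicCompletionMap (L := L) (IsCMField.complexConj L) hw) t = η) →
            γ₁ ∈ unitaryGroupOfForm (galAdicCompletionMap (L := L) (IsCMField.complexConj L) hw) (Matrix.diagonal dg) →
            (γ₁ : Matrix (Fin 2) (Fin 2) (w.1.adicCompletion L)).charpoly = (((γH.1.val : GL (Fin 2) (UnitaryGroup.LocalRing L v)).val.map (Pi.evalRingHom (fun w' : UnitaryGroup.PlacesOver L v => w'.1.adicCompletion L) w))).charpoly →
          ∀ (φ : (Fin 2 → (w.1.adicCompletion L)) →+ (w₁.1.adicCompletion E')) (h : (w₁.1.adicCompletion E')) (φ' : (Fin 2 → (w.1.adicCompletion L)) →+ (w₁.1.adicCompletion E')) (h' : (w₁.1.adicCompletion E')),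
            (∀ (c : (w.1.adicCompletion L)) (x : Fin 2 → (w.1.adicCompletion L)), φ (c • x) = toPlace w.1 w₁ c * φ x) →
            Function.Injective φ →
            Function.Surjective φ →
            (∀ x, φ ((((localNonsplitEquiv (IsCMField.complexConj L) (Matrix.of fun i j : Fin 2 => if i.val + j.val + 1 = 2 then (1 : L) else 0) (IsCMField.complexConj_ne_one L) w hw γH.1 : ↥(unitaryGroupOfForm (galAdicCompletionMap (L := L) (IsCMField.complexConj L) hw) (placeForm (Matrix.of fun i j : Fin 2 => if i.val + j.val + 1 = 2 then (1 : L) else 0) w.1))) : GL (Fin 2) (w.1.adicCompletion L)) : Matrix (Fin 2) (Fin 2) (w.1.adicCompletion L)).mulVec x) = lam * φ x) →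
            (∀ x y, toPlace w.1 w₁ (pairing (galAdicCompletionMap (L := L) (IsCMField.complexConj L) hw) (placeForm (Matrix.of fun i j : Fin 2 => if i.val + j.val + 1 = 2 then (1 : L) else 0) w.1) x y) = h * Θ (φ x) * φ y + galAdicCompletionMap (L := E') c₁ hw₁ (h * Θ (φ x) * φ y)) →
            Θ h = h →
            h ≠ 0 →
            (∃ x : (w₁.1.adicCompletion E'), x ≠ 0 ∧ h * Θ x * x + galAdicCompletionMap (L := E') c₁ hw₁ (h * Θ x * x) = 0) →
            (∀ (c : (w.1.adicCompletion L)) (x : Fin 2 → (w.1.adicCompletion L)), φ' (c • x) = toPlace w.1 w₁ c * φ' x) →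
            Function.Injective φ' →
            Function.Surjective φ' →
            (∀ x, φ' ((γ₁ : Matrix (Fin 2) (Fin 2) (w.1.adicCompletion L)).mulVec x) = lam * φ' x) →
            (∀ x y, toPlace w.1 w₁ (pairing (galAdicCompletionMap (L := L) (IsCMField.complexConj L) hw) (Matrix.diagonal dg) x y) = h' * Θ (φ' x) * φ' y + galAdicCompletionMap (L := E') c₁ hw₁ (h' * Θ (φ' x) * φ' y)) →
            Θ h' = h' →
            h' ≠ 0 →
            (∀ (t : (w.1.adicCompletion L)) (n : ℤ), Valued.v (toPlace w.1 w₁ t) = Valued.v (toPlace w.1 w₁ ϖ) ^ n ↔ Valued.v t = Valued.v ϖ ^ n) →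
            (∀ c : (w₁.1.adicCompletion E'), galAdicCompletionMap (L := E') c₁ hw₁ c = c → c ≠ 0 → Valued.v c ≤ 1 → ∃ n : ℕ, Valued.v c = Valued.v (toPlace w.1 w₁ ϖ) ^ n) →
            (∀ t : (w₁.1.adicCompletion E'), galAdicCompletionMap (L := E') c₁ hw₁ t = t → Valued.v t < 1 → Valued.v t ≤ Valued.v (toPlace w.1 w₁ ϖ)) →
              ∀ (J R R' : ℕ) (f f' : ℕ → ℕ → AddSubgroup (w₁.1.adicCompletion E') → ℕ),
              {M₃ : Submodule (Valued.integer (w.1.adicCompletion L)) (Fin 3 → (w.1.adicCompletion L)) | IsVertexLattice (galAdicCompletionMap (L := L) (IsCMField.complexConj L) hw) ϖ ((StdForm.antidiagonal 3).over (w.1.adicCompletion L)) 0 M₃ ∧ mapGL (endoGL (((localNonsplitEquiv (IsCMField.complexConj L) (Matrix.of fun i j : Fin 2 => if i.val + j.val + 1 = 2 then (1 : L) else 0) (IsCMField.complexConj_ne_one L) w hw γH.1 : ↥(unitaryGroupOfForm (galAdicCompletionMap (L := L) (IsCMField.complexConj L) hw) (placeForm (Matrix.of fun i j : Fin 2 =>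 if i.val + j.val + 1 = 2 then (1 : L) else 0) w.1))) : GL (Fin 2) (w.1.adicCompletion L)), ((localNonsplitEquiv (IsCMField.complexConj L) (Matrix.of fun i j : Fin 1 => if i.val + j.val + 1 = 1 then (1 : L) else 0) (IsCMField.complexConj_ne_one L) w hw γH.2).val : GL (Fin 1) (w.1.adicCompletion L)))) M₃ = M₃}.Finite →
              (∀ M₃ : Submodule (Valued.integer (w.1.adicCompletion L)) (Fin 3 → (w.1.adicCompletion L)), IsVertexLattice (galAdicCompletionMap (L := L) (IsCMField.complexConj L) hw) ϖ ((StdForm.antidiagonal 3).over (w.1.adicCompletion L)) 0 M₃ → mapGL (endoGL (((localNonsplitEquiv (IsCMField.complexConj L) (Matrix.of fun i j : Fin 2 => if i.val + j.val + 1 = 2 then (1 : L) else 0) (IsCMField.complexConj_ne_one L) w hw γH.1 : ↥(unitaryGroupOfForm (galAdicCompletionMap (L := L) (IsCMField.complexConj L) hw) (placeForm (Matrix.of fun i j : Fin 2 => if i.val + j.val + 1 = 2 then (1 : L) else 0) w.1))) : GL (Fin 2) (w.1.adicCompletion L)), ((localNonsplitEquiv (IsCMField.complexConj L) (Matrix.of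 fun i j : Fin 1 => if i.val + j.val + 1 = 1 then (1 : L) else 0) (IsCMField.complexConj_ne_one L) w hw γH.2).val : GL (Fin 1) (w.1.adicCompletion L)))) M₃ = M₃ →
                ∀ b : ℕ, (∀ c : (w.1.adicCompletion L), (Pi.single 1 c : Fin 3 → (w.1.adicCompletion L)) ∈ M₃ ↔ Valued.v c ≤ Valued.v ϖ ^ b) → b ≤ R) →
              {M₃ : Submodule (Valued.integer (w.1.adicCompletion L)) (Fin 3 → (w.1.adicCompletion L)) | IsSelfDualLattice (galAdicCompletionMap (L := L) (IsCMField.complexConj L) hw) ϖ (!![(Matrix.diagonal dg) 0 0, 0, (Matrix.diagonal dg) 0 1; 0, η, 0; (Matrix.diagonal dg) 1 0, 0, (Matrix.diagonal dg) 1 1] : Matrix (Fin 3) (Fin 3) (w.1.adicCompletion L)) M₃ ∧ mapGL (endoGL (γ₁, ((localNonsplitEquiv (IsCMField.complexConj L) (Matrix.of fun i j : Fin 1 => if i.val + j.val + 1 = 1 then (1 : L) else 0) (IsCMField.complexConj_ne_one L) w hw γH.2).val : GL (Fin 1) (w.1.adicCompletion L)))) M₃ = M₃}.Finite →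
              (∀ M₃ : Submodule (Valued.integer (w.1.adicCompletion L)) (Fin 3 → (w.1.adicCompletion L)), IsSelfDualLattice (galAdicCompletionMap (L := L) (IsCMField.complexConj L) hw) ϖ (!![(Matrix.diagonal dg) 0 0, 0, (Matrix.diagonal dg) 0 1; 0, η, 0; (Matrix.diagonal dg) 1 0, 0, (Matrix.diagonal dg) 1 1] : Matrix (Fin 3) (Fin 3) (w.1.adicCompletion L)) M₃ → mapGL (endoGL (γ₁, ((localNonsplitEquiv (IsCMField.complexConj L) (Matrix.of fun i j : Fin 1 => if i.val + j.val + 1 = 1 then (1 : L) else 0) (IsCMField.complexConj_ne_one L) w hw γH.2).val : GL (Fin 1) (w.1.adicCompletion L)))) M₃ = M₃ →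
                ∀ b : ℕ, (∀ c : (w.1.adicCompletion L), (Pi.single 1 c : Fin 3 → (w.1.adicCompletion L)) ∈ M₃ ↔ Valued.v c ≤ Valued.v ϖ ^ b) → b ≤ R') →
              ¬ IsOrd (galAdicCompletionMap (L := E') c₁ hw₁) α (toPlace w.1 w₁ ϖ ^ (J + 1)) lam →
              (∀ j a, (levelSet (galAdicCompletionMap (L := E') c₁ hw₁) Θ α (toPlace w.1 w₁ ϖ) h j a).Finite) →
              (∀ j a, (levelSet (galAdicCompletionMap (L := E') c₁ hw₁) Θ α (toPlace w.1 w₁ ϖ) h' j a).Finite) →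
              Valued.v ((((localNonsplitEquiv (IsCMField.complexConj L) (Matrix.of fun i j : Fin 1 => if i.val + j.val + 1 = 1 then (1 : L) else 0) (IsCMField.complexConj_ne_one L) w hw γH.2).val : GL (Fin 1) (w.1.adicCompletion L)) : Matrix (Fin 1) (Fin 1) (w.1.adicCompletion L)) 0 0) = 1 →
              (∀ (b j : ℕ) (Λ : AddSubgroup (w₁.1.adicCompletion E')) (x₀ : (w₁.1.adicCompletion E')) (r : (w.1.adicCompletion L)), 1 ≤ b → x₀ ≠ 0 →
                (∀ x, x ∈ Λ ↔ ∃ z, IsOrd (galAdicCompletionMap (L := E') c₁ hw₁) α (toPlace w.1 w₁ ϖ ^ j) z ∧ x = x₀ * z) →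
                IsOrd (galAdicCompletionMap (L := E') c₁ hw₁) α (toPlace w.1 w₁ ϖ ^ j) (dualGen (galAdicCompletionMap (L := E') c₁ hw₁) Θ α (toPlace w.1 w₁ ϖ ^ j) h x₀) → ¬ IsOrd (galAdicCompletionMap (L := E') c₁ hw₁) α (toPlace w.1 w₁ ϖ ^ j) (dualGen (galAdicCompletionMap (L := E') c₁ hw₁) Θ α (toPlace w.1 w₁ ϖ ^ j) h x₀ / toPlace w.1 w₁ ϖ) →
                Valued.v (dualGen (galAdicCompletionMap (L := E') c₁ hw₁) Θ α (toPlace w.1 w₁ ϖ ^ j) h x₀) = Valued.v (toPlace w.1 w₁ ϖ) ^ b →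
                (∀ b', (∀ x ∈ Λ, Valued.v (h * Θ x * b' + galAdicCompletionMap (L := E') c₁ hw₁ (h * Θ x * b')) ≤ 1) → (lam - toPlace w.1 w₁ ((((localNonsplitEquiv (IsCMField.complexConj L) (Matrix.of fun i j : Fin 1 => if i.val + j.val + 1 = 1 then (1 : L) else 0) (IsCMField.complexConj_ne_one L) w hw γH.2).val : GL (Fin 1) (w.1.adicCompletion L)) : Matrix (Fin 1) (Fin 1) (w.1.adicCompletion L)) 0 0)) * b' ∈ Λ) →
                IsOrd (galAdicCompletionMap (L := E') c₁ hw₁) α (toPlace w.1 w₁ ϖ ^ j) lam → toPlace w.1 w₁ r = glueUnit (galAdicCompletionMap (L := E') c₁ hw₁) Θ α (toPlace w.1 w₁ ϖ ^ j) h (toPlace w.1 w₁ ϖ) (toPlace w.1 w₁ 1) x₀ b →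
                f b j Λ = Nat.card {x : 𝒪[(w.1.adicCompletion L)] ⧸ 𝓂[(w.1.adicCompletion L)] ^ (2 * b) // ∃ u' : 𝒪[(w.1.adicCompletion L)], Ideal.Quotient.mk (𝓂[(w.1.adicCompletion L)] ^ (2 * b)) u' = x ∧
                  Valued.v ((u' : (w.1.adicCompletion L)) * (galAdicCompletionMap (L := L) (IsCMField.complexConj L) hw) u' - r) ≤ Valued.v (ϖ ^ (2 * b))}) →
              (∀ (b j : ℕ) (Λ : AddSubgroup (w₁.1.adicCompletion E')) (x₀ : (w₁.1.adicCompletion E')) (r : (w.1.adicCompletion L)), 1 ≤ b → x₀ ≠ 0 →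
                (∀ x, x ∈ Λ ↔ ∃ z, IsOrd (galAdicCompletionMap (L := E') c₁ hw₁) α (toPlace w.1 w₁ ϖ ^ j) z ∧ x = x₀ * z) →
                IsOrd (galAdicCompletionMap (L := E') c₁ hw₁) α (toPlace w.1 w₁ ϖ ^ j) (dualGen (galAdicCompletionMap (L := E') c₁ hw₁) Θ α (toPlace w.1 w₁ ϖ ^ j) h' x₀) → ¬ IsOrd (galAdicCompletionMap (L := E') c₁ hw₁) α (toPlace w.1 w₁ ϖ ^ j) (dualGen (galAdicCompletionMap (L := E') c₁ hw₁) Θ α (toPlace w.1 w₁ ϖ ^ j) h' x₀ / toPlace w.1 w₁ ϖ) →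
                Valued.v (dualGen (galAdicCompletionMap (L := E') c₁ hw₁) Θ α (toPlace w.1 w₁ ϖ ^ j) h' x₀) = Valued.v (toPlace w.1 w₁ ϖ) ^ b →
                (∀ b', (∀ x ∈ Λ, Valued.v (h' * Θ x * b' + galAdicCompletionMap (L := E') c₁ hw₁ (h' * Θ x * b')) ≤ 1) → (lam - toPlace w.1 w₁ ((((localNonsplitEquiv (IsCMField.complexConj L) (Matrix.of fun i j : Fin 1 => if i.val + j.val + 1 = 1 then (1 : L) else 0) (IsCMField.complexConj_ne_one L) w hw γH.2).val : GL (Fin 1) (w.1.adicCompletion L)) : Matrix (Fin 1) (Fin 1) (w.1.adicCompletion L)) 0 0)) * b' ∈ Λ) →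
                IsOrd (galAdicCompletionMap (L := E') c₁ hw₁) α (toPlace w.1 w₁ ϖ ^ j) lam → toPlace w.1 w₁ r = glueUnit (galAdicCompletionMap (L := E') c₁ hw₁) Θ α (toPlace w.1 w₁ ϖ ^ j) h' (toPlace w.1 w₁ ϖ) (toPlace w.1 w₁ η) x₀ b →
                f' b j Λ = Nat.card {x : 𝒪[(w.1.adicCompletion L)] ⧸ 𝓂[(w.1.adicCompletion L)] ^ (2 * b) // ∃ u' : 𝒪[(w.1.adicCompletion L)], Ideal.Quotient.mk (𝓂[(w.1.adicCompletion L)] ^ (2 * b)) u' = x ∧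
                  Valued.v ((u' : (w.1.adicCompletion L)) * (galAdicCompletionMap (L := L) (IsCMField.complexConj L) hw) u' - r) ≤ Valued.v (ϖ ^ (2 * b))}) →
            (∀ f₀ : (w₁.1.adicCompletion E'), galAdicCompletionMap (L := E') c₁ hw₁ f₀ = f₀ → Θ f₀ = f₀ → Valued.v f₀ = 1 → ∃ z : (w₁.1.adicCompletion E'), z * Θ z = f₀) ∧
            (∀ (m : ℕ) (β : (v.adicCompletion ↥(maximalRealSubfield L))ˣ), Valued.v (((finCharpolyTwo L v γH).eval (finGammaTwo L v γH)) w) = Valued.v ((toPlace v w (HeckeCharacter.uniformizer ↥(maximalRealSubfield L) v : v.adicCompletion ↥(maximalRealSubfield L))) ^ m) →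
              toPlace v w (β : (v.adicCompletion ↥(maximalRealSubfield L))) = -(((finCharpolyTwo L v γH).eval (finGammaTwo L v γH)) w * (finGammaTwo L v γH w ^ 2 + ((γH.1.val.val : Matrix (Fin 2) (Fin 2) (UnitaryGroup.LocalRing L v)).map (Pi.evalRingHom (fun w' : UnitaryGroup.PlacesOver L v => w'.1.adicCompletion L) w)).det)) / (2 * finGammaTwo L v γH w ^ 2 * ((γH.1.val.val : Matrix (Fin 2) (Fin 2) (UnitaryGroup.LocalRing L v)).map (Pi.evalRingHom (fun w' : UnitaryGroup.PlacesOver L v => w'.1.adicCompletion L) w)).det) →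
              (((Fintype.card (Valued.ResidueField (w.1.adicCompletion L))) : ℤ) - 1) * ((Fintype.card (Valued.ResidueField (w.1.adicCompletion L))) : ℤ) ^ ks *
                ((({M : Submodule (Valued.integer (w.1.adicCompletion L)) (Fin 3 → w.1.adicCompletion L) |
              IsVertexLattice (galAdicCompletionMap (L := L) (IsCMField.complexConj L) hw) ϖ ((StdForm.antidiagonal 3).over (w.1.adicCompletion L)) 0 M ∧
                mapGL ((localNonsplitEquiv (IsCMField.complexConj L) (Matrix.of fun i j : Fin 3 => if i.val + j.val + 1 = 3 then (1 : L) else 0) (IsCMField.complexConj_ne_one L) w hw th : ↥(unitaryGroupOfForm (galAdicCompletionMap (L := L) (IsCMField.complexConj L) hw) (placeForm (Matrix.of fun i j : Fin 3 => if i.val + j.val + 1 = 3 then (1 : L) else 0) w.1))) : GL (Fin 3) (w.1.adicCompletion L)) M = M ∧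
                (LatticeInLevel ϖ a ((((localNonsplitEquiv (IsCMField.complexConj L) (Matrix.of fun i j : Fin 3 => if i.val + j.val + 1 = 3 then (1 : L) else 0) (IsCMField.complexConj_ne_one L) w hw th : ↥(unitaryGroupOfForm (galAdicCompletionMap (L := L) (IsCMField.complexConj L) hw) (placeForm (Matrix.of fun i j : Fin 3 => if i.val + j.val + 1 = 3 then (1 : L) else 0) w.1))) : GL (Fin 3) (w.1.adicCompletion L)) : Matrix (Fin 3) (Fin 3) (w.1.adicCompletion L)) - 1) M ∧
                  LatticeInLevel ϖ b (((((localNonsplitEquiv (IsCMField.complexConj L) (Matrix.of fun i j : Fin 3 => if i.val + j.val + 1 = 3 then (1 : L) else 0) (IsCMField.complexConj_ne_one L) w hw th : ↥(unitaryGroupOfForm (galAdicCompletionMap (L := L) (IsCMField.complexConj L) hw) (placeForm (Matrix.of fun i j : Fin 3 => if i.val + j.val + 1 = 3 then (1 : L) else 0) w.1))) : GL (Fin 3) (w.1.adicCompletion L)) : Matrix (Fin 3) (Fin 3) (w.1.adicCompletion L)) - 1) *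
                    ((((localNonsplitEquiv (IsCMField.complexConj L) (Matrix.of fun i j : Fin 3 => if i.val + j.val + 1 = 3 then (1 : L) else 0) (IsCMField.complexConj_ne_one L) w hw th : ↥(unitaryGroupOfForm (galAdicCompletionMap (L := L) (IsCMField.complexConj L) hw) (placeForm (Matrix.of fun i j : Fin 3 => if i.val + j.val + 1 = 3 then (1 : L) else 0) w.1))) : GL (Fin 3) (w.1.adicCompletion L)) : Matrix (Fin 3) (Fin 3) (w.1.adicCompletion L)) - 1)) M)}.ncard : ℕ) : ℤ) -
                  (({M : Submodule (Valued.integer (w.1.adicCompletion L)) (Fin 3 → w.1.adicCompletion L) |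
              IsVertexLattice (galAdicCompletionMap (L := L) (IsCMField.complexConj L) hw) ϖ ((StdForm.antidiagonal 3).over (w.1.adicCompletion L)) 0 M ∧
                mapGL ((localNonsplitEquiv (IsCMField.complexConj L) (Matrix.of fun i j : Fin 3 => if i.val + j.val + 1 = 3 then (1 : L) else 0) (IsCMField.complexConj_ne_one L) w hw ta : ↥(unitaryGroupOfForm (galAdicCompletionMap (L := L) (IsCMField.complexConj L) hw) (placeForm (Matrix.of fun i j : Fin 3 => if i.val + j.val + 1 = 3 then (1 : L) else 0) w.1))) : GL (Fin 3) (w.1.adicCompletion L)) M = M ∧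
                (LatticeInLevel ϖ a ((((localNonsplitEquiv (IsCMField.complexConj L) (Matrix.of fun i j : Fin 3 => if i.val + j.val + 1 = 3 then (1 : L) else 0) (IsCMField.complexConj_ne_one L) w hw ta : ↥(unitaryGroupOfForm (galAdicCompletionMap (L := L) (IsCMField.complexConj L) hw) (placeForm (Matrix.of fun i j : Fin 3 => if i.val + j.val + 1 = 3 then (1 : L) else 0) w.1))) : GL (Fin 3) (w.1.adicCompletion L)) : Matrix (Fin 3) (Fin 3) (w.1.adicCompletion L)) - 1) M ∧
                  LatticeInLevel ϖ b (((((localNonsplitEquiv (IsCMField.complexConj L) (Matrix.of fun i j : Fin 3 => if i.val + j.val + 1 = 3 then (1 : L) else 0) (IsCMField.complexConj_ne_one L) w hw ta : ↥(unitaryGroupOfForm (galAdicCompletionMap (L := L) (IsCMField.complexConj L) hw) (placeForm (Matrix.of fun i j : Fin 3 => if i.val + j.val + 1 = 3 then (1 : L) else 0) w.1))) : GL (Fin 3) (w.1.adicCompletion L)) : Matrix (Fin 3) (Fin 3) (w.1.adicCompletion L)) - 1) *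
                    ((((localNonsplitEquiv (IsCMField.complexConj L) (Matrix.of fun i j : Fin 3 => if i.val + j.val + 1 = 3 then (1 : L) else 0) (IsCMField.complexConj_ne_one L) w hw ta : ↥(unitaryGroupOfForm (galAdicCompletionMap (L := L) (IsCMField.complexConj L) hw) (placeForm (Matrix.of fun i j : Fin 3 => if i.val + j.val + 1 = 3 then (1 : L) else 0) w.1))) : GL (Fin 3) (w.1.adicCompletion L)) : Matrix (Fin 3) (Fin 3) (w.1.adicCompletion L)) - 1)) M)}.ncard : ℕ) : ℤ)) =
              (Literature.NumberTheory.QuadraticForms.hilbertSymbol (v.adicCompletion ↥(maximalRealSubfield L)) (β : (v.adicCompletion ↥(maximalRealSubfield L))) (algebraMap ↥(maximalRealSubfield L) _ ((cmQuadraticGenerator L : 𝓞 ↥(maximalRealSubfield L)) : ↥(maximalRealSubfield L))) : ℤ) * ((Fintype.card (Valued.ResidueField (w.1.adicCompletion L))) : ℤ) ^ m *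
                ((((Fintype.card (Valued.ResidueField (w.1.adicCompletion L))) : ℤ) - 1) * (((Nat.card (MulAction.fixedBy (((UnitaryGroup.cmDatum L 2 (Matrix.of fun i j : Fin 2 => if i.val + j.val + 1 = 2 then (1 : L) else 0)).Local v) ⧸ cmLocalIntegralLevel L 2 (Matrix.of fun i j : Fin 2 => if i.val + j.val + 1 = 2 then (1 : L) else 0) v) γH.1)) + d % 2 : ℕ) : ℤ) + 2 - 2 * ((Fintype.card (Valued.ResidueField (w.1.adicCompletion L))) : ℤ) ^ T)) := by
  classical
  -- THE NEIGHBOURHOOD `V`: block congruence at `ϖ^(2d+5tE+2)` (★ brick 6) ∩ m-tokens `≥ a+b+2d+2` ∩ the near-1 ball `|u_w − 1|, |det − 1|, |tr − 2| ≤ |ϖ^{2(a+b+2d+2)}|`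
  obtain ⟨V₁, hV₁, hVc⟩ := F0P3cDyRamTypeTwoBlockCongruenceNhds.exists_nhds_one_block_congr L v w
    (c := ϖ ^ (2 * d + 4 * tE + 2 + tE)) (F0P3cDyRamUniformizerPowerTube.pow_ne_zero_of_v hϖ _)
  have hB0 : ϖ ^ (2 * (a + b + 2 * d + 2)) ≠ 0 := F0P3cDyRamUniformizerPowerTube.pow_ne_zero_of_v hϖ _
  obtain ⟨V₂, hV₂, hV₂c⟩ := ((eventually_nhds_one_le_tokenDepth L v w (a + b + 2 * d + 2)).and
    ((eventually_nhds_one_valued_sub_one_le L v w hB0).and (eventually_nhds_one_valued_trace_sub_two_le L v w hB0))).exists_mem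
  refine ⟨V₁ ∩ V₂, Filter.inter_mem hV₁ hV₂, ?_⟩
  intro γH hγV hreg htyp E' _i₁ _i₂ _i₃ _i₄ c₁ δ m₀ s w₁ hw₁ Θ α lam hc₁ hδ hδ0 hm₀ hs0 hdisc hDD htr hχ hρρ hvρ hρj hjv hjfix hΘj hΘΘ
    hΘρ hvΘ hα hα1 hint h2lam hlam2 hρlam hΘlam hlam huniq hA hτα th ta P₁ dg η γ₁ hth hta hfc hdg1 hdgσ hησ hη1 hηN hγ₁U hchar
    φ h φ' h' hφs hφi hφo hφγ hform hΘh hh hiso hφ's hφ'i hφ'o hφ'γ hform' hΘh' hh' hjpow hEval hϖmax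
    J R R' f f' hfinF hR hfinF' hR' hJ hfinLS hfinLS' hu hf hf'
  obtain ⟨hg, hu₂⟩ := hVc γH hγV.1
  obtain ⟨hN₀, ⟨huc0, hdet0⟩, htr0⟩ := hV₂c γH hγV.2
  haveI : Finite 𝓀[w₁.1.adicCompletion E'] := finite_residueField_adicCompletion E' w₁.1
  haveI : IsDiscreteValuationRing 𝒪[w₁.1.adicCompletion E'] := inferInstanceAs (IsDiscreteValuationRing (w₁.1.adicCompletionIntegers E'))
  haveI : IsDiscreteValuationRing 𝒪[w.1.adicCompletion L] := inferInstanceAs (IsDiscreteValuationRing (w.1.adicCompletionIntegers L))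
  haveI : Finite 𝓀[w.1.adicCompletion L] := Finite.of_fintype (Valued.ResidueField (w.1.adicCompletion L))
  have hjv1 : ∀ a, Valued.v (toPlace w.1 w₁ a) = Valued.v a := fun a =>
    F0P3cDyRamUnramifiedQuadraticCompletionDictionary.valued_toPlace_of_v_sub_galAdicCompletionMap_eq_one E' c₁ w.1 hc₁ w₁ hw₁ hα1 hA a
  have hϖE : Valued.v (toPlace w.1 w₁ ϖ) = WithZero.exp (-1 : ℤ) := by rw [hjv1, hϖ]
  refine ⟨F0P3cDyRamTypeUBottomFacts.forall_fixed_fixed_isNorm_of_typeU hvρ hΘΘ hvΘ hα1 hA hτα hϖE, ?_⟩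
  intro m β hm hβ
  -- LETTERS OF THE PLACE DATUM, the depth of the block congruence and the TUBE (★ bricks 5∕7, as ★ (A))
  obtain ⟨hσσ, hσv, -, hfixw, hdd, hd1, h2t⟩ := id hD
  have hN : tE < 2 * d + 4 * tE + 2 + tE ∧ 2 * tE + 2 ≤ 2 * d + 4 * tE + 2 + tE := by omega
  have hc2 : Valued.v (ϖ ^ (2 * d + 4 * tE + 2 + tE)) < Valued.v (2 : w.1.adicCompletion L) :=
    F0P3cDyRamUniformizerPowerTube.v_pow_lt_v_two hϖ h2t hN.1
  have htr2 := F0P3cDyRamTypeTwoTubeLetters.v_trace_eq_v_two hc2 hg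
  have htube := F0P3cDyRamTypeTwoTubeLetters.v_disc_lt_tube hc2 (F0P3cDyRamUniformizerPowerTube.v_pow_sq_lt_tube hϖ h2t hN.2) hg
  have h20 : (2 : w.1.adicCompletion L) ≠ 0 := fun h0 => by
    have := h2t; rw [h0, map_zero] at this
    exact (pow_ne_zero tE (by rw [hϖ]; exact WithZero.exp_ne_zero)) this.symm
  have ht0 : (((γH.1.val : GL (Fin 2) (UnitaryGroup.LocalRing L v)).val.map
      (Pi.evalRingHom (fun w' : UnitaryGroup.PlacesOver L v => w'.1.adicCompletion L) w))).trace ≠ 0 := fun h0 => by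
    rw [h0, map_zero] at htr2; exact h20 ((map_eq_zero _).1 htr2.symm)
  -- THE H-SIDE ORGAN (★ LH4-p09) and THE TYPE-(A) BRANCH KILL (★ brick 8): the INERT law `hFix`, `dK = 0`
  have hϖF := HeckeCharacter.valued_uniformizer (K := ↥(maximalRealSubfield L)) v
  obtain ⟨αH, sH, g, uτ, wτ, z, n, dK, hαH, hvαH, hsH, hsg, hz, hdat, huO, hbranch, hdK, hlev⟩ :=
    F0P3cDyRamHSideClosedForm.hSide_closedForm_of_tube_exists L v w hw hϖF he hD γH.1 htyp htube
  have hσι : ∀ y, (galAdicCompletionMap (L := L) (IsCMField.complexConj L) hw) (toPlace v w y) = toPlace v w y :=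
    fun y => galAdicCompletionMap_toPlace (IsCMField.complexConj L) w w hw y
  have hι2 : ∀ y, Valued.v (toPlace v w y) = Valued.v y ^ 2 :=
    fun y => valued_toPlace_eq_pow_two_of_ramified (IsCMField.complexConj L) w (IsCMField.complexConj_ne_one L) hw he y
  have hresE : ∀ x : w.1.adicCompletion L, Valued.v x ≤ 1 →
      ∃ y : v.adicCompletion ↥(maximalRealSubfield L), Valued.v (toPlace v w y) ≤ 1 ∧ Valued.v (x - toPlace v w y) < 1 := fun x hx => by
    obtain ⟨y, hy1, hy⟩ := exists_valued_sub_toPlace_lt_one_of_ne_one L (IsCMField.complexConj L) v w (IsCMField.complexConj_ne_one L) hw he x hx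
    exact ⟨y, by rw [hι2]; exact pow_le_one₀ zero_le hy1, hy⟩
  have hσϖ : (galAdicCompletionMap (L := L) (IsCMField.complexConj L) hw) ϖ ≠ ϖ := fun h0 => by
    have h1 := hdd
    rw [h0, sub_self, map_zero] at h1
    exact pow_ne_zero d (by rw [hϖ]; exact WithZero.exp_ne_zero) h1.symm
  have h2M : Valued.v (2 : w₁.1.adicCompletion E') < 1 := by rw [← map_ofNat (toPlace w.1 w₁) 2, hjv1]; exact h2v
  have h2Mne : (2 : w₁.1.adicCompletion E') ≠ 0 := by rw [← map_ofNat (toPlace w.1 w₁) 2]; exact (map_ne_zero _).2 h20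
  have hαH0 : αH ≠ 0 := fun h0 => by
    rw [h0, map_zero] at hvαH
    rcases hvαH with h1 | h1
    · exact zero_ne_one h1
    · exact WithZero.zero_ne_coe h1
  obtain ⟨hwO, hanis, hdK0, hFix⟩ := hbranch.resolve_right fun hE =>
    F0P3cDyRamTypeASelector.not_eisensteinDatum_typeA (toPlace v w) hι2 _ hσι hresE hσϖ (toPlace w.1 w₁) hjv1 _ Θ hρρ hvρ hjfix hΘj hΘΘ
      hΘρ hvΘ hα1 hA hτα h2M h2Mne hlam2 hρlam hΘlam hDD ht0 rfl rfl hαH0 hsH hsg (Matrix.GeneralLinearGroup.det_ne_zero g) hϖF hz hdat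
      hE.1 hE.2.1
  subst hdK0
  -- THE `Φ₁`-COORDINATE `u = jE u₀₀` (★ brick 1), THE DEPTH LETTER `m ≥ a + b + 2d + 2` (★ brick 4 ∘ the token-depth `V`)
  have hH1 : IsUnit ((placeForm (Matrix.of fun i j : Fin 1 => if i.val + j.val + 1 = 1 then (1 : L) else 0) w.1) 0 0) := by
    rw [placeForm_antidiagOne]; simp [StdForm.over, StdForm.antidiagonal_J_apply, Fin.rev]
  obtain ⟨hρu, hu1⟩ := F0P3cDyRamTypeUBottomFacts.map_fixed_and_mul_map_eq_one (ρ := (galAdicCompletionMap (L := E') c₁ hw₁)) (Θ := Θ) (galAdicCompletionMap (L := L) (IsCMField.complexConj L) hw) (toPlace w.1 w₁) hΘj hjfix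
    (F0P3cDyRamTypeUBottomFacts.mul_map_eq_one_of_mem_unitary_one (galAdicCompletionMap (L := L) (IsCMField.complexConj L) hw) hH1
      (localNonsplitEquiv (IsCMField.complexConj L) (Matrix.of fun i j : Fin 1 => if i.val + j.val + 1 = 1 then (1 : L) else 0) (IsCMField.complexConj_ne_one L) w hw γH.2).2)
  have hma : a + b + 2 * d + 2 ≤ m := hN₀ m hm
  have htok := hm
  rw [eval_finCharpolyTwo_finGammaTwo_apply_eq_quadratic, F0P3cDyRamFixedPointCensusTypeTwoPrelude.valued_toPlace_uniformizer_pow L w hw he m] at htok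
  have hmE : Valued.v (lam - toPlace w.1 w₁ ((((localNonsplitEquiv (IsCMField.complexConj L) (Matrix.of fun i j : Fin 1 => if i.val + j.val + 1 = 1 then (1 : L) else 0) (IsCMField.complexConj_ne_one L) w hw γH.2).val : GL (Fin 1) (w.1.adicCompletion L)) : Matrix (Fin 1) (Fin 1) (w.1.adicCompletion L)) 0 0)) = WithZero.exp (-(m : ℤ)) :=
    F0P3cDyRamTypeTwoDepthDictionary.v_sub_eq_exp_neg_of_token (ρ := (galAdicCompletionMap (L := E') c₁ hw₁)) (toPlace w.1 w₁) hjv1 hvρ hjfix hρlam hlam2 _ htok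
  -- THE CONDUCTOR LEVEL `jλ = 2n` (★ brick 3; `dK = 0`)
  have hsq := F0P3cDyRamTypeTwoLevelDictionary.sq_sub_map_eq_map_disc (ρ := (galAdicCompletionMap (L := E') c₁ hw₁)) (toPlace w.1 w₁) hρlam hlam2
  have hv2sq : Valued.v (4 : w.1.adicCompletion L) = Valued.v (2 : w.1.adicCompletion L) ^ 2 := by rw [show (4 : w.1.adicCompletion L) = 2 * 2 by norm_num, map_mul, sq]
  have hdiscv : Valued.v ((((γH.1.val : GL (Fin 2) (UnitaryGroup.LocalRing L v)).val.map (Pi.evalRingHom (fun w' : UnitaryGroup.PlacesOver L v => w'.1.adicCompletion L) w))).trace ^ 2 - 4 * (((γH.1.val : GL (Fin 2) (UnitaryGroup.LocalRing L v)).val.map (Pi.evalRingHom (fun w' : UnitaryGroup.PlacesOver L v => w'.1.adicCompletion L) w))).det) = Valued.v ϖ ^ (2 * (2 * n)) := by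
    have h : Valued.v ϖ ^ (2 * (2 * n + 0)) * Valued.v (((γH.1.val : GL (Fin 2) (UnitaryGroup.LocalRing L v)).val.map (Pi.evalRingHom (fun w' : UnitaryGroup.PlacesOver L v => w'.1.adicCompletion L) w))).trace ^ 2 = Valued.v (4 * ((((γH.1.val : GL (Fin 2) (UnitaryGroup.LocalRing L v)).val.map (Pi.evalRingHom (fun w' : UnitaryGroup.PlacesOver L v => w'.1.adicCompletion L) w))).trace ^ 2 - 4 * (((γH.1.val : GL (Fin 2) (UnitaryGroup.LocalRing L v)).val.map (Pi.evalRingHom (fun w' : UnitaryGroup.PlacesOver L v => w'.1.adicCompletion L) w))).det)) := hlev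
    rw [add_zero, map_mul, htr2, hv2sq, mul_comm] at h
    exact (mul_right_injective₀ (pow_ne_zero _ ((Valuation.ne_zero_iff _).2 h20)) h).symm
  have hjlv : Valued.v (lam - (galAdicCompletionMap (L := E') c₁ hw₁) lam) = WithZero.exp (-((2 * n : ℕ) : ℤ)) := by
    refine F0P3cDyRamTypeTwoDepthDictionary.eq_exp_neg_of_mul_self_eq ?_
    rw [← map_mul, ← sq, hsq, hjv1, hdiscv, ← map_pow, F0P3cDyRamUniformizerPowerTube.v_pow_eq_exp_neg hϖ]
    congr 1
  have hjl : Valued.v ((lam - toPlace w.1 w₁ ((((localNonsplitEquiv (IsCMField.complexConj L) (Matrix.of fun i j : Fin 1 => if i.val + j.val + 1 = 1 then (1 : L) else 0) (IsCMField.complexConj_ne_one L) w hw γH.2).val : GL (Fin 1) (w.1.adicCompletion L)) : Matrix (Fin 1) (Fin 1) (w.1.adicCompletion L)) 0 0)) - (galAdicCompletionMap (L := E') c₁ hw₁) (lam - toPlace w.1 w₁ ((((localNonsplitEquiv (IsCMField.complexConj L) (Matrix.of fun i j : Fin 1 => if i.val + j.val + 1 = 1 then (1 : L) else 0) (IsCMField.complexConj_ne_one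 L) w hw γH.2).val : GL (Fin 1) (w.1.adicCompletion L)) : Matrix (Fin 1) (Fin 1) (w.1.adicCompletion L)) 0 0))) = WithZero.exp (-((2 * n : ℕ) : ℤ)) := by
    rw [map_sub (galAdicCompletionMap (L := E') c₁ hw₁), hρu, sub_sub_sub_cancel_right]; exact hjlv
  have hjlα : Valued.v (lam - (galAdicCompletionMap (L := E') c₁ hw₁) lam) = Valued.v (toPlace w.1 w₁ ϖ) ^ (2 * n) * Valued.v (α - (galAdicCompletionMap (L := E') c₁ hw₁) α) := by
    rw [hA, mul_one, hjlv, ← map_pow, F0P3cDyRamUniformizerPowerTube.v_pow_eq_exp_neg hϖE]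
  -- THE HERMITIAN LETTERS of the two plane forms, THE FLIP UNIT (★ (β)), UNITARITY OF THE TWO LITERALS and GAP-R (★ LH4-p05) — as ★ (A)
  have hH₂ : IsUnit (placeForm (Matrix.of fun i j : Fin 2 => if i.val + j.val + 1 = 2 then (1 : L) else 0) w.1).det := isUnit_det_placeForm L v w _ (isUnit_antidiagOne_det L 2).ne_zero
  have hH₂σ : ((placeForm (Matrix.of fun i j : Fin 2 => if i.val + j.val + 1 = 2 then (1 : L) else 0) w.1).map (galAdicCompletionMap (L := L) (IsCMField.complexConj L) hw))ᵀ = (placeForm (Matrix.of fun i j : Fin 2 => if i.val + j.val + 1 = 2 then (1 : L) else 0) w.1) := placeForm_map_transpose_of_hermitian L v w hw _ (antidiagOne_isHermitian L 2)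
  have hdg0 : ∀ i, dg i ≠ 0 := fun i h0 => by have h1 := hdg1 i; rw [h0, map_zero] at h1; exact zero_ne_one h1
  have hH₂' : IsUnit (Matrix.diagonal dg).det := by
    rw [Matrix.det_diagonal]; exact isUnit_iff_ne_zero.2 (Finset.prod_ne_zero_iff.2 fun i _ => hdg0 i)
  have hDgσ : ((Matrix.diagonal dg).map (galAdicCompletionMap (L := L) (IsCMField.complexConj L) hw))ᵀ = Matrix.diagonal dg := by
    rw [Matrix.diagonal_map (map_zero _), Matrix.diagonal_transpose]
    exact congrArg Matrix.diagonal (funext hdgσ)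
  obtain ⟨zf, ξ, hz1, hzξ, hσξ, hξN⟩ := F0P3cDyRamConeWeightHalfSplit.exists_flipUnit_of_forall_fixed_fixed_isNorm (galAdicCompletionMap (L := L) (IsCMField.complexConj L) hw) hD (toPlace w.1 w₁) hvΘ hΘj hjfix hjpow
    (F0P3cDyRamTypeUBottomFacts.forall_fixed_fixed_isNorm_of_typeU hvρ hΘΘ hvΘ hα1 hA hτα hϖE)
  have hblock : placeForm (Matrix.of fun i j : Fin 3 => if i.val + j.val + 1 = 3 then (1 : L) else 0) w.1 = (!![(placeForm (Matrix.of fun i j : Fin 2 => if i.val + j.val + 1 = 2 then (1 : L) else 0) w.1) 0 0, 0, (placeForm (Matrix.of fun i j : Fin 2 => if i.val + j.val + 1 = 2 then (1 : L) else 0) w.1) 0 1; 0, (1 : w.1.adicCompletion L), 0; (placeForm (Matrix.of fun i j : Fin 2 => if i.val + j.val + 1 = 2 then (1 : L) else 0) w.1) 1 0, 0, (placeForm (Matrix.of fun i j : Fin 2 => if i.val + j.val + 1 = 2 then (1 : L) else 0) w.1) 1 1] : Matrix (Fin 3) (Fin 3) (w.1.adicCompletion L)) := by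
    rw [placeForm_antidiagOne, placeForm_antidiagOne, F0P3cDyRamFixedPointCensusTypeTwoPrelude.antidiagonal_three_over_eq_block_antidiagonal_two]
  have hΓ0 : endoGL ((((localNonsplitEquiv (IsCMField.complexConj L) (Matrix.of fun i j : Fin 2 => if i.val + j.val + 1 = 2 then (1 : L) else 0) (IsCMField.complexConj_ne_one L) w hw γH.1) : ↥(unitaryGroupOfForm (galAdicCompletionMap (L := L) (IsCMField.complexConj L) hw) (placeForm (Matrix.of fun i j : Fin 2 => if i.val + j.val + 1 = 2 then (1 : L) else 0) w.1))) : GL (Fin 2) (w.1.adicCompletion L)), (((localNonsplitEquiv (IsCMField.complexConj L) (Matrix.of fun i j : Fin 1 => if i.val + j.val + 1 = 1 then (1 : L) else 0) (IsCMField.complexConj_ne_one L) w hw γH.2)).val : GL (Fin 1) (w.1.adicCompletion L))) ∈ unitaryGroupOfForm (galAdicCompletionMap (L := L) (IsCMField.complexConj L) hw) (placeForm (Matrix.of fun i j : Fin 3 => if i.val + j.val + 1 = 3 then (1 : L) else 0) w.1) := by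
    rw [← hth]
    exact (localNonsplitEquiv (IsCMField.complexConj L) (Matrix.of fun i j : Fin 3 => if i.val + j.val + 1 = 3 then (1 : L) else 0) (IsCMField.complexConj_ne_one L) w hw th).2
  have hΓ : endoGL ((((localNonsplitEquiv (IsCMField.complexConj L) (Matrix.of fun i j : Fin 2 => if i.val + j.val + 1 = 2 then (1 : L) else 0) (IsCMField.complexConj_ne_one L) w hw γH.1) : ↥(unitaryGroupOfForm (galAdicCompletionMap (L := L) (IsCMField.complexConj L) hw) (placeForm (Matrix.of fun i j : Fin 2 => if i.val + j.val + 1 = 2 then (1 : L) else 0) w.1))) : GL (Fin 2) (w.1.adicCompletion L)), (((localNonsplitEquiv (IsCMField.complexConj L) (Matrix.of fun i j : Fin 1 => if i.val + j.val + 1 = 1 then (1 : L) else 0) (IsCMField.complexConj_ne_one L) w hw γH.2)).val : GL (Fin 1) (w.1.adicCompletion L))) ∈ unitaryGroupOfForm (galAdicCompletionMap (L := L) (IsCMField.complexConj L) hw) (!![(placeForm (Matrix.of fun i j : Fin 2 => if i.val + j.val + 1 = 2 then (1 : L) else 0) w.1) 0 0, 0, (placeForm (Matrix.of fun i j : Fin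 2 => if i.val + j.val + 1 = 2 then (1 : L) else 0) w.1) 0 1; 0, (1 : w.1.adicCompletion L), 0; (placeForm (Matrix.of fun i j : Fin 2 => if i.val + j.val + 1 = 2 then (1 : L) else 0) w.1) 1 0, 0, (placeForm (Matrix.of fun i j : Fin 2 => if i.val + j.val + 1 = 2 then (1 : L) else 0) w.1) 1 1] : Matrix (Fin 3) (Fin 3) (w.1.adicCompletion L)) := by
    rw [← hblock]; exact hΓ0
  have hmem' : P₁ * endoGL (γ₁, (((localNonsplitEquiv (IsCMField.complexConj L) (Matrix.of fun i j : Fin 1 => if i.val + j.val + 1 = 1 then (1 : L) else 0) (IsCMField.complexConj_ne_one L) w hw γH.2)).val : GL (Fin 1) (w.1.adicCompletion L))) * P₁⁻¹ ∈ unitaryGroupOfForm (galAdicCompletionMap (L := L) (IsCMField.complexConj L) hw) (placeForm (Matrix.of fun i j : Fin 3 => if i.val + j.val + 1 = 3 then (1 : L) else 0) w.1) := by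
    rw [← hta]
    exact (localNonsplitEquiv (IsCMField.complexConj L) (Matrix.of fun i j : Fin 3 => if i.val + j.val + 1 = 3 then (1 : L) else 0) (IsCMField.complexConj_ne_one L) w hw ta).2
  have hΓ' : endoGL (γ₁, (((localNonsplitEquiv (IsCMField.complexConj L) (Matrix.of fun i j : Fin 1 => if i.val + j.val + 1 = 1 then (1 : L) else 0) (IsCMField.complexConj_ne_one L) w hw γH.2)).val : GL (Fin 1) (w.1.adicCompletion L))) ∈ unitaryGroupOfForm (galAdicCompletionMap (L := L) (IsCMField.complexConj L) hw) (!![(Matrix.diagonal dg) 0 0, 0, (Matrix.diagonal dg) 0 1; 0, η, 0; (Matrix.diagonal dg) 1 0, 0, (Matrix.diagonal dg) 1 1] : Matrix (Fin 3) (Fin 3) (w.1.adicCompletion L)) := by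
    rw [← hfc]; exact (conj_mem_unitaryGroupOfForm_iff (galAdicCompletionMap (L := L) (IsCMField.complexConj L) hw) P₁ _ (endoGL (γ₁, (((localNonsplitEquiv (IsCMField.complexConj L) (Matrix.of fun i j : Fin 1 => if i.val + j.val + 1 = 1 then (1 : L) else 0) (IsCMField.complexConj_ne_one L) w hw γH.2)).val : GL (Fin 1) (w.1.adicCompletion L))))).1 hmem'
  have hR₁ := fun M₃ (hM₃ : IsSelfDualLattice (galAdicCompletionMap (L := L) (IsCMField.complexConj L) hw) ϖ
      (!![(placeForm (Matrix.of fun i j : Fin 2 => if i.val + j.val + 1 = 2 then (1 : L) else 0) w.1) 0 0, 0, (placeForm (Matrix.of fun i j : Fin 2 => if i.val + j.val + 1 = 2 then (1 : L) else 0) w.1) 0 1; 0, (1 : w.1.adicCompletion L), 0; (placeForm (Matrix.of fun i j : Fin 2 => if i.val + j.val + 1 = 2 then (1 : L) else 0) w.1) 1 0, 0, (placeForm (Matrix.of fun i j : Fin 2 => if i.val + j.val + 1 = 2 then (1 : L) else 0) w.1) 1 1] : Matrix (Fin 3) (Fin 3) (w.1.adicCompletion L)) M₃) =>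
    hR M₃ (by have h0 := hM₃; rw [← hblock, placeForm_antidiagOne] at h0; exact h0)
  have hRcells : ∀ j b, 1 ≤ b → IsOrd (galAdicCompletionMap (L := E') c₁ hw₁) α (toPlace w.1 w₁ ϖ ^ j) lam →
      (levelSetDep (galAdicCompletionMap (L := E') c₁ hw₁) Θ α (toPlace w.1 w₁ ϖ) h j b (lam - toPlace w.1 w₁ ((((localNonsplitEquiv (IsCMField.complexConj L) (Matrix.of fun i j : Fin 1 => if i.val + j.val + 1 = 1 then (1 : L) else 0) (IsCMField.complexConj_ne_one L) w hw γH.2).val : GL (Fin 1) (w.1.adicCompletion L)) : Matrix (Fin 1) (Fin 1) (w.1.adicCompletion L)) 0 0))).Nonempty → b ≤ R :=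
    fun j b hb hlamj hne => F0P3cDyRamConeTubeBound.le_of_levelSetDep_nonempty (galAdicCompletionMap (L := L) (IsCMField.complexConj L) hw) hσσ hσv hϖ hD h2v hH₂ hH₂σ (hW := (1 : w.1.adicCompletion L)) (by rw [map_one]) (map_one _)
      (toPlace w.1 w₁) hρρ hvρ hα hα1 hint hΘΘ hΘρ hvΘ hΘj hjv hjfix hjpow hϖmax φ hφs hφi hφo hφγ hlam hΘh hh hform zf hz1 ξ hzξ hσξ hξN (((localNonsplitEquiv (IsCMField.complexConj L) (Matrix.of fun i j : Fin 1 => if i.val + j.val + 1 = 1 then (1 : L) else 0) (IsCMField.complexConj_ne_one L) w hw γH.2)).val : GL (Fin 1) (w.1.adicCompletion L)) hΓ hu hR₁ hb hlamj hne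
  have hRcells' : ∀ j b, 1 ≤ b → IsOrd (galAdicCompletionMap (L := E') c₁ hw₁) α (toPlace w.1 w₁ ϖ ^ j) lam →
      (levelSetDep (galAdicCompletionMap (L := E') c₁ hw₁) Θ α (toPlace w.1 w₁ ϖ) h' j b (lam - toPlace w.1 w₁ ((((localNonsplitEquiv (IsCMField.complexConj L) (Matrix.of fun i j : Fin 1 => if i.val + j.val + 1 = 1 then (1 : L) else 0) (IsCMField.complexConj_ne_one L) w hw γH.2).val : GL (Fin 1) (w.1.adicCompletion L)) : Matrix (Fin 1) (Fin 1) (w.1.adicCompletion L)) 0 0))).Nonempty → b ≤ R' :=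
    fun j b hb hlamj hne => F0P3cDyRamConeTubeBound.le_of_levelSetDep_nonempty (galAdicCompletionMap (L := L) (IsCMField.complexConj L) hw) hσσ hσv hϖ hD h2v hH₂' hDgσ hη1 hησ
      (toPlace w.1 w₁) hρρ hvρ hα hα1 hint hΘΘ hΘρ hvΘ hΘj hjv hjfix hjpow hϖmax φ' hφ's hφ'i hφ'o hφ'γ hlam hΘh' hh' hform' zf hz1 ξ hzξ hσξ hξN (((localNonsplitEquiv (IsCMField.complexConj L) (Matrix.of fun i j : Fin 1 => if i.val + j.val + 1 = 1 then (1 : L) else 0) (IsCMField.complexConj_ne_one L) w hw γH.2)).val : GL (Fin 1) (w.1.adicCompletion L)) hΓ' hu hR' hb hlamj hne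
  -- THE NEAR-1 LEVEL LETTERS (★ p860127 §2): `|λ − 1| ≤ |ϖ|^B`, `B = a + b + 2d + 2` ⇒ the level clauses, the deep trace token, the tokens `m₁ = m − a`, `nν ≥ B`, `m₂ = m + nν − b`
  have hϖpow : ∀ k : ℕ, Valued.v (ϖ ^ k) = Valued.v ϖ ^ k := fun k => map_pow _ _ _
  rw [hϖpow] at huc0 hdet0 htr0
  have hpw : ∀ k l : ℕ, k ≤ l → Valued.v ϖ ^ l ≤ Valued.v ϖ ^ k := fun k l hkl =>
    (F0P3cDyRamLevelsSocketPrelude.pow_le_pow_iff_of_uniformiser hϖ l k).2 hkl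
  have hϖEpow : ∀ k : ℕ, Valued.v (toPlace w.1 w₁ ϖ ^ k) = Valued.v ϖ ^ k := fun k => by rw [map_pow, hjv1]
  have hlam1B : Valued.v (lam - 1) ≤ Valued.v ϖ ^ (a + b + 2 * d + 2) :=
    F0P3cDyRamLevelsSocketPrelude.v_sub_one_le_pow (toPlace w.1 w₁) hvρ hρlam hlam2 hjv1 hdet0 htr0
  have huc1 : Valued.v (((((localNonsplitEquiv (IsCMField.complexConj L) (Matrix.of fun i j : Fin 1 => if i.val + j.val + 1 = 1 then (1 : L) else 0) (IsCMField.complexConj_ne_one L) w hw γH.2).val : GL (Fin 1) (w.1.adicCompletion L)) : Matrix (Fin 1) (Fin 1) (w.1.adicCompletion L)) 0 0) - 1) ≤ Valued.v ϖ ^ (2 * (a + b + 2 * d + 2)) := huc0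
  have hlev : Valued.v (lam - 1) ≤ Valued.v (toPlace w.1 w₁ ϖ ^ a) := by rw [hϖEpow]; exact hlam1B.trans (hpw _ _ (by omega))
  have hlev2 : Valued.v ((lam - 1) * (lam - 1)) ≤ Valued.v (toPlace w.1 w₁ ϖ ^ b) := by
    rw [hϖEpow, map_mul]; refine (mul_le_mul' hlam1B hlam1B).trans ?_; rw [← pow_add]; exact hpw _ _ (by omega)
  have hdeep : Valued.v (lam + (galAdicCompletionMap (L := E') c₁ hw₁) lam - 2) ≤ Valued.v (toPlace w.1 w₁ ϖ) ^ (b - a) := by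
    rw [hjv1]; exact (F0P3cDyRamLevelsSocketPrelude.v_add_map_sub_two_le (toPlace w.1 w₁) hρlam hjv1 htr0).trans (hpw _ _ (by omega))
  have huc : Valued.v (((((localNonsplitEquiv (IsCMField.complexConj L) (Matrix.of fun i j : Fin 1 => if i.val + j.val + 1 = 1 then (1 : L) else 0) (IsCMField.complexConj_ne_one L) w hw γH.2).val : GL (Fin 1) (w.1.adicCompletion L)) : Matrix (Fin 1) (Fin 1) (w.1.adicCompletion L)) 0 0) - 1) ≤ Valued.v ϖ ^ a := huc1.trans (hpw _ _ (by omega))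
  have huc2 : Valued.v ((((((localNonsplitEquiv (IsCMField.complexConj L) (Matrix.of fun i j : Fin 1 => if i.val + j.val + 1 = 1 then (1 : L) else 0) (IsCMField.complexConj_ne_one L) w hw γH.2).val : GL (Fin 1) (w.1.adicCompletion L)) : Matrix (Fin 1) (Fin 1) (w.1.adicCompletion L)) 0 0) - 1) ^ 2) ≤ Valued.v ϖ ^ b := by
    rw [map_pow, sq]; refine (mul_le_mul' huc1 huc1).trans ?_; rw [← pow_add]; exact hpw _ _ (by omega)
  have hajl : a ≤ 2 * n := by
    have h1 : Valued.v (lam - (galAdicCompletionMap (L := E') c₁ hw₁) lam) ≤ Valued.v ϖ ^ (a + b + 2 * d + 2) := by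
      rw [show lam - (galAdicCompletionMap (L := E') c₁ hw₁) lam = (lam - 1) - (galAdicCompletionMap (L := E') c₁ hw₁) (lam - 1) by rw [map_sub, map_one]; ring]
      exact Valuation.map_sub_le _ hlam1B (by rw [hvρ]; exact hlam1B)
    rw [hjlv, ← hϖpow (a + b + 2 * d + 2), F0P3cDyRamUniformizerPowerTube.v_pow_eq_exp_neg hϖ, WithZero.exp_le_exp] at h1
    omega
  have hρlamne : (galAdicCompletionMap (L := E') c₁ hw₁) lam ≠ lam := fun h0 => by
    have h1 := hjlv; rw [h0, sub_self, map_zero] at h1; exact WithZero.zero_ne_coe h1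
  obtain ⟨-, hν0⟩ := F0P3cDyRamLevelsSocketPrelude.sub_ne_zero_and_add_sub_two_ne_zero hρlamne hρu
  have hν1 : Valued.v (lam + toPlace w.1 w₁ ((((localNonsplitEquiv (IsCMField.complexConj L) (Matrix.of fun i j : Fin 1 => if i.val + j.val + 1 = 1 then (1 : L) else 0) (IsCMField.complexConj_ne_one L) w hw γH.2).val : GL (Fin 1) (w.1.adicCompletion L)) : Matrix (Fin 1) (Fin 1) (w.1.adicCompletion L)) 0 0) - 2) ≤ Valued.v ϖ ^ (a + b + 2 * d + 2) := by
    rw [show lam + toPlace w.1 w₁ ((((localNonsplitEquiv (IsCMField.complexConj L) (Matrix.of fun i j : Fin 1 => if i.val + j.val + 1 = 1 then (1 : L) else 0) (IsCMField.complexConj_ne_one L) w hw γH.2).val : GL (Fin 1) (w.1.adicCompletion L)) : Matrix (Fin 1) (Fin 1) (w.1.adicCompletion L)) 0 0) - 2 = (lam - 1) + toPlace w.1 w₁ (((((localNonsplitEquiv (IsCMField.complexConj L) (Matrix.of fun i j : Fin 1 => if i.val + j.val + 1 = 1 then (1 : L) else 0) (IsCMField.complexConj_ne_one L) w hw γH.2).val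 : GL (Fin 1) (w.1.adicCompletion L)) : Matrix (Fin 1) (Fin 1) (w.1.adicCompletion L)) 0 0) - 1) by rw [map_sub, map_one]; ring]
    exact Valuation.map_add_le _ hlam1B (by rw [hjv1]; exact huc1.trans (hpw _ _ (by omega)))
  have hϖle1 : Valued.v ϖ ^ (a + b + 2 * d + 2) ≤ 1 := pow_le_one₀ zero_le (by rw [hϖ, ← WithZero.exp_zero, WithZero.exp_le_exp]; norm_num)
  obtain ⟨nν, hnν⟩ := F0P3cDyRamLevelsSocketPrelude.exists_eq_pow_of_le_one hϖE hν0 (hν1.trans hϖle1)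
  have hνB : a + b + 2 * d + 2 ≤ nν := by
    have h1 := hν1; rw [hnν, hjv1] at h1
    exact (F0P3cDyRamLevelsSocketPrelude.pow_le_pow_iff_of_uniformiser hϖ _ _).1 h1
  have hm₁ : Valued.v ((toPlace w.1 w₁ ϖ ^ a)⁻¹ * (lam - toPlace w.1 w₁ ((((localNonsplitEquiv (IsCMField.complexConj L) (Matrix.of fun i j : Fin 1 => if i.val + j.val + 1 = 1 then (1 : L) else 0) (IsCMField.complexConj_ne_one L) w hw γH.2).val : GL (Fin 1) (w.1.adicCompletion L)) : Matrix (Fin 1) (Fin 1) (w.1.adicCompletion L)) 0 0))) = WithZero.exp (-((m - a : ℕ) : ℤ)) := by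
    rw [map_mul, map_inv₀, hϖEpow, hmE, hϖ, ← WithZero.exp_nsmul, nsmul_eq_mul, mul_neg, mul_one, ← WithZero.exp_neg, neg_neg,
      ← WithZero.exp_add]
    congr 1; omega
  have hm₂ : Valued.v ((toPlace w.1 w₁ ϖ ^ b)⁻¹ * ((lam - 1) * (lam - 1) - toPlace w.1 w₁ ((((((localNonsplitEquiv (IsCMField.complexConj L) (Matrix.of fun i j : Fin 1 => if i.val + j.val + 1 = 1 then (1 : L) else 0) (IsCMField.complexConj_ne_one L) w hw γH.2).val : GL (Fin 1) (w.1.adicCompletion L)) : Matrix (Fin 1) (Fin 1) (w.1.adicCompletion L)) 0 0) - 1) ^ 2))) =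
      WithZero.exp (-((m + nν - b : ℕ) : ℤ)) := by
    rw [sub_one_sq_sub_map_sub_one_sq, map_mul, map_inv₀, hϖEpow, map_mul, hmE, hnν, hjv1, hϖ, ← WithZero.exp_nsmul, ← WithZero.exp_nsmul,
      nsmul_eq_mul, nsmul_eq_mul, mul_neg, mul_one, mul_neg, mul_one, ← WithZero.exp_neg, neg_neg, ← WithZero.exp_add, ← WithZero.exp_add]
    congr 1; omega
  -- THE LEVEL-PIECE CENSUS OF EACH LITERAL IN CUTOFF CURRENCY (★ p860083 §1 ∕ §2)
  have hcut := ncard_typeZero_fixed_endoGL_levels_eq_cutoff_unr L w hw hϖ (toPlace w.1 w₁) hρρ hvρ hα hα1 hint hΘΘ hΘρ hvΘ hΘj hjv hjfix hjpow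
    hEval hϖmax φ hφs hφi hφo (((localNonsplitEquiv (IsCMField.complexConj L) (Matrix.of fun i j : Fin 2 => if i.val + j.val + 1 = 2 then (1 : L) else 0) (IsCMField.complexConj_ne_one L) w hw γH.1) : ↥(unitaryGroupOfForm (galAdicCompletionMap (L := L) (IsCMField.complexConj L) hw) (placeForm (Matrix.of fun i j : Fin 2 => if i.val + j.val + 1 = 2 then (1 : L) else 0) w.1))) : GL (Fin 2) (w.1.adicCompletion L)) hφγ hlam hΘh hh hform (((localNonsplitEquiv (IsCMField.complexConj L) (Matrix.of fun i j : Fin 1 => if i.val + j.val + 1 = 1 then (1 : L) else 0) (IsCMField.complexConj_ne_one L) w hw γH.2)).val : GL (Fin 1) (w.1.adicCompletion L)) hΓ0 hu a b huc huc2 hfinF hR hJ hfinLS f hf hA hϖE hm₁ hm₂ (by omega) hjlα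
    hlev hajl hlev2 hdeep hnν
  have hcut' := ncard_typeZero_fixed_conj_endoGL_levels_eq_cutoff_unr L w hw hϖ (toPlace w.1 w₁) hρρ hvρ hα hα1 hint hΘΘ hΘρ hvΘ hΘj hjv hjfix
    hjpow hEval hϖmax P₁ dg η γ₁ (((localNonsplitEquiv (IsCMField.complexConj L) (Matrix.of fun i j : Fin 1 => if i.val + j.val + 1 = 1 then (1 : L) else 0) (IsCMField.complexConj_ne_one L) w hw γH.2)).val : GL (Fin 1) (w.1.adicCompletion L)) hfc hdg1 hdgσ hησ hη1 hmem' hu a b huc huc2 φ' hφ's hφ'i hφ'o hφ'γ hlam hΘh' hh' hform' hfinF' hR' hJ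
    hfinLS' f' hf' hA hϖE hm₁ hm₂ (by omega) hjlα hlev hajl hlev2 hdeep hnν
  rw [hth, hta, hcut, hcut']
  -- THE REMAINING FRAME LETTERS (★ brick 1 transport, ★ p10 residue count, ★ brick 2 anisotropy, ★ p858055, the sign ★ O-Sign, realizability ★ LH4-p14) and THE FRAME LAW
  have hqc : Nat.card 𝓀[(w.1.adicCompletion L)] = Fintype.card (Valued.ResidueField (w.1.adicCompletion L)) := Nat.card_eq_fintype_card
  obtain ⟨hddE, hfixE, h2E⟩ := F0P3cDyRamTypeUBottomFacts.transported_datum (ρ := (galAdicCompletionMap (L := E') c₁ hw₁)) (galAdicCompletionMap (L := L) (IsCMField.complexConj L) hw) hD (toPlace w.1 w₁) hΘj hjfix hjpow hϖE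
  have hqM := F0P3cDyRamUnramifiedQuadraticCompletionDictionary.natCard_residueField_eq_sq_of_v_sub_galAdicCompletionMap_eq_one E' c₁ w.1 hc₁ w₁ hw₁ hα1 hA
  rw [hqc] at hqM
  have hfc' : formCongr (galAdicCompletionMap (L := L) (IsCMField.complexConj L) hw) P₁ ((StdForm.antidiagonal 3).over (w.1.adicCompletion L)) =
      (!![(Matrix.diagonal dg) 0 0, 0, (Matrix.diagonal dg) 0 1; 0, η, 0; (Matrix.diagonal dg) 1 0, 0, (Matrix.diagonal dg) 1 1] : Matrix (Fin 3) (Fin 3) (w.1.adicCompletion L)) := by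
    rw [← placeForm_antidiagOne]; exact hfc
  have haniso := F0P3cDyRamTypeTwoAnisotropyOfFrame.not_exists_herm_self_eq_zero_of_lineModel (ρ := (galAdicCompletionMap (L := E') c₁ hw₁)) (Θ := Θ) (galAdicCompletionMap (L := L) (IsCMField.complexConj L) hw) (Matrix.diagonal dg)
    (toPlace w.1 w₁) φ' hφ'o hform' (F0P3cDyRamTypeTwoAnisotropyOfFrame.not_exists_pairing_diagonal_self_eq_zero_of_formCongr (galAdicCompletionMap (L := L) (IsCMField.complexConj L) hw) P₁ dg η hfc' hdgσ hdg0 hηN)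
  have hlam' : lam * Θ lam = 1 := by rw [mul_comm]; exact hΘlam
  have hq2 : 2 ≤ Fintype.card (Valued.ResidueField (w.1.adicCompletion L)) := by rw [← hqc]; exact Finite.one_lt_card
  have hd2 := (F0P3cDyRamSideNormCriterionRamK.two_le_of_datum_of_v_two_lt_one hD h2v).1
  have hjl2 : (2 * n) % 2 = 0 := by omega
  have hε : ((hilbertSymbol (v.adicCompletion ↥(maximalRealSubfield L)) (β : (v.adicCompletion ↥(maximalRealSubfield L)))
      (algebraMap ↥(maximalRealSubfield L) _ ((cmQuadraticGenerator L : 𝓞 ↥(maximalRealSubfield L)) : ↥(maximalRealSubfield L))) : ℤ) : ℚ) = (-1) ^ (m + d) := by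
    rw [F0P3cDyRamOrderCountCensusUnrSign.sign_typeA L w hw he ϖ hϖ d tE hD h2v γH hg hu₂ E' c₁ w₁ hw₁ Θ α lam hc₁ hDD htr hρρ hvρ hρj hjv hjfix hΘj hΘΘ
      hΘρ hvΘ hα1 hint hlam2 hρlam hΘlam hA hτα hu hjlv hm hβ]
    push_cast; ring
  have hreal := F0P3cDyRamTokenRealizabilityUnrOfFrame.hreal_of_frame_typeU hD h2v hρρ hvρ hΘΘ hΘρ hvΘ (toPlace w.1 w₁) hjfix hΘj hjv1 hα1 hA hτα hd2
    hlam' hρu hu1 hmE hjl (by omega) hjl2 _ hε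
  have hn2 : 2 * n / 2 = n := by omega
  have hFix' : (Fintype.card (Valued.ResidueField (w.1.adicCompletion L)) - 1) *
      (Nat.card (MulAction.fixedBy (((UnitaryGroup.cmDatum L 2 (Matrix.of fun i j : Fin 2 => if i.val + j.val + 1 = 2 then (1 : L) else 0)).Local v) ⧸
        cmLocalIntegralLevel L 2 (Matrix.of fun i j : Fin 2 => if i.val + j.val + 1 = 2 then (1 : L) else 0) v) γH.1) + d % 2) + 2 =
      (Fintype.card (Valued.ResidueField (w.1.adicCompletion L)) + 1) * Fintype.card (Valued.ResidueField (w.1.adicCompletion L)) ^ (2 * n / 2) := by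
    rw [hn2]; exact hFix
  exact levelsCutCensus_unr_law_of_frame (galAdicCompletionMap (L := L) (IsCMField.complexConj L) hw) hσσ hσv hϖ hD h2v hH₂σ hDgσ hη1 hησ (toPlace w.1 w₁) hρρ hvρ hA hα1 hint hΘΘ hΘρ hvΘ hΘj hjv hjfix
    hjpow hϖmax φ hφs hφi hφo hφγ hlam hΘh hh hform φ' hφ's hφ'i hφ'o hφ'γ hΘh' hh' hform' zf hz1 ξ hzξ hσξ hξN ((((localNonsplitEquiv (IsCMField.complexConj L) (Matrix.of fun i j : Fin 1 => if i.val + j.val + 1 = 1 then (1 : L) else 0) (IsCMField.complexConj_ne_one L) w hw γH.2).val : GL (Fin 1) (w.1.adicCompletion L)) : Matrix (Fin 1) (Fin 1) (w.1.adicCompletion L)) 0 0) hqc hqM hτα hϖE hddE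
    hfixE h2E hiso haniso hlam' hρu hu1 hmE hjl hq2 hd2 hjl2 _ (hilbertSymbol_eq_one_or_eq_neg_one _ _) hreal a b ks T hab1 hks hT0 hT1
    (by omega) (show (m + nν - b) + b = m + nν by omega) hRcells hRcells' hfinLS hfinLS' f f' hf hf' hFix'

end Summit.HodgeConjecture.HodgeConjecture.Cruxes.H413.F0P3cDyRamLevelsCensusUnr

end
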